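import Literature.MathematicalPhysics.QuantumFieldTheory.Balaban1983to89.B9Thm312WholeBlocksNbr

/-!
# `Balaban1983to89.B9Thm312WholeBlocksNbrRec` — [B9] Theorem 3.12 (p. 423): the L² BLOCK (3.46) of a kernel family co-read on the metric
# neighbourhood of y by a Sect.-D propagator, INDEXED IN THE RECORD ORDER of the six members (n = 3 ↦ the MIXED member ∇_UA∇\*_U, n = 4 ↦ the pair
# family ∇_ν∇_μA, n = 5 ↦ the pair family A∇\*_ν∇\*_μ), and the reading-free six block bounds behind both orders

T. Bałaban, *Propagators for lattice gauge theories in a background field*, Commun. Math. Phys. **99** (1985) 389–434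
[`Balaban1985BackgroundPropagators`, "B9"]; [4] = T. Bałaban, *Propagators and renormalization transformations for lattice
gauge theories. II*, Commun. Math. Phys. **96** (1984) 223–250 [`Balaban1984PropagatorsII`].

statement-level skeleton of published theorems with citation tags; proofs where landed; nothing here is a claim about the
Yang–Mills mass gap

THE PRINTED LOCI are those of `…B9Thm312WholeBlocksNbr` (verbatim there).  INDEX MAP (referee ref-A's located point IDX34, 2026-08-27): PRINT
(3.46) p. 398 lists the six L² members as n = 0 G′, 1 ∇_UG′, 2 G′∇\*_U, 3 ∇_U∇_UG′, 4 ∇_UG′∇\*_U, 5 G′∇\*_U∇\*_U; the RECORD's kernel families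
(`Node00.kernelFamilyS.l2`, `kernelFamilyB.l2`) order them n = 0 O, 1 ∇O, 2 O∇\*, **3 ∇_νO∇\*_μ (mixed), 4 ∇_ν∇_μO, 5 O∇\*_ν∇\*_μ** — a permutation,
content-neutral for the node statement (which quantifies over all n with the weights [t², t, t, 1, 1, 1]) but NOT for the index-specific co-reading
binders `L2ReadsNbr K n … T`.  `…BlocksNbr.l2Block_of_step_nbr` binds the print order; THIS FILE binds the record order (n06-k's Pair face
`B9RWSumsDefinitePinsPair` does the same), so that the leaf can be knitted at K := the record's family.

* `blockBds_of_step` — the six block-L² bounds of A ∈ {G, G₁} at (constL2N, ρ_f), READING-FREE (the body of `l2Block_of_step_nbr` before its last line).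
* `l2Block_of_blockBds_nbrRec` — six printed-shape block bounds + six `L2ReadsNbr` IN THE RECORD ORDER ⇒ `L2Block K (mN·m·Cev·CL²·e^{rδ}·K_L) δ U`.
* ★ `l2Block_of_step_nbrRec` — the record-order twin of `l2Block_of_step_nbr`.

HONEST SCOPE.  Index routing and kernel bookkeeping only; nothing of [B9] or [4] is asserted; every schema, letter and reading is a HYPOTHESIS of
printed ∕ definitional shape.  NOT a node discharge, NOT summit progress; count-neutral; one finite lattice at a time; nothing continuum, nothing
about the mass gap.  Cell `pub-ymgap` (HUMAN RULING D-0062), Track A node N06 [B9], N06-ASSIGNMENT v1 rows 20–21 (bundle F7), seat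
`pub-ymgap-dag-n06-l` (g5), 2026-08-27.
-/

namespace Literature.MathematicalPhysics.QuantumFieldTheory.Balaban1983to89.B9Thm312WholeBlocksNbrRec

open Literature.MathematicalPhysics.QuantumFieldTheory.Balaban1983to89
open Finset B6RandomWalk B6RandomWalkHom B9Thm34Ext B9Thm37Glue B9Thm37GlueCor36 B11SectG B9SectDSup B9SectDL2Decay
open B9Thm37AllNorms B9Thm37AllNormsInstances B9FromB6 B9FromB6ModelSignsOn B9SectBStepWhole B9Thm312Whole B9Thm312WholeLeaf
open B9Thm312WholeLeft B9RWSums343Holder B9RWSums346Schur B9RWSumsReadsRel B9RWSumsReadsNbr B9Ineq347 B9Thm312WholeClasses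
open B9Thm312WholeHolder B9Thm312WholeL2 B9Thm312WholeBlocksRel B9RWSums346SecondDiff B9Thm312WholeBlocksNbr

noncomputable section

section OneMember

variable {g : B9.Geometry} {B : B9.Backgrounds} {X Y Z W P : Type}
variable [Fintype X] [Fintype Y] [Fintype P] [Fintype g.Site] [DecidableEq g.Site]
variable {R₀ : ℝ} {H₀ : Prop}

omit [DecidableEq g.Site] in
/-- ★ **THEOREM 3.12 — THE SIX BLOCK-L² BOUNDS (3.46) OF ONE SECT.-D PROPAGATOR AT ONE MEMBER AND ONE CONFIGURATION, READING-FREE** (the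
operator-level content of `…BlocksNbr.l2Block_of_step_nbr`, before any co-reading: so that the member lines can be read in EITHER index order).  Data at U: A with
(Δ_a − T)A = I and G₀Δ_a = I; Theorem 3.3 for G₀ in the sup classes (`he0 he1 he2`) and the block-L² classes with the second-order members per
pair (`hL2 : Thm33G0L2P …`); the perturbation step on 𝔠⁽¹⁾, 𝔠⁽²⁾ (`hK1 hK2`), its derivative (`hKD`) and its block-L² bound (`hT2`); A symmetric and
(∇_UA)ᵀ = A∇\*_U; [4] Lemma 2.1 as the row sum at σ and three scale transfers (γ = 1, ½, −1); the co-readings `L2ReadsNbr` of `K.l2 0…5` by A, ∇_UA,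
A∇\*_U are NOT needed here: the conclusion is the conjunction of the six block bounds of A, ∇_UA, A∇\*_U, `familyOp (q ↦ ∇_{q.1}∇_{q.2}∘A)`, ∇_UA∇\*_U,
`familyOp (q ↦ A∘∇\*_{q.1}∇\*_{q.2})` at the constant `constL2N …`·pref6(Lʲη)ₙ (printed weights [(Lʲη)², Lʲη, Lʲη, 1, 1, 1]) and the rate ρ_f.  Provisos:
ρ ≦ δ₀, ρ + σ ≦ δ_K, θc < 1, B₂θ₂c² < 1, 0 ≦ ρ_f, ρ_f + σ ≦ (1 − α)ρ, ρ_f + 2σ + αρ ≦ ρ.  Nothing of print asserted.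
[cite: Balaban1985BackgroundPropagators, Thm 3.12 p.423 + Thm 3.3 p.399 + (3.46) p.398 + (3.39) p.397 + (3.130)–(3.131) pp.421–422 + (3.138) p.423; Balaban1984PropagatorsII, (2.51)–(2.52) p.232 + Lemma 2.1 (2.60)–(2.61) p.234] -/
theorem blockBds_of_step (hG : GeoOK g) {U : B.Cfg} (𝔬 : Ops g B X Y Z W)
    (Dd Dds : B.Cfg → P → Module.End ℝ (X → ℝ)) {A T : Module.End ℝ (X → ℝ)}
    {θ θD θ₂ B₀ B₂ δ₀ δK ρ ρf σ α c Λ₁ Λh Λm : ℝ}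
    (hrow : RowSum (toB6 g R₀ H₀) σ c)
    (hθ : 0 ≤ θ) (hθD : 0 ≤ θD) (hθ₂ : 0 ≤ θ₂) (hB₀ : 0 ≤ B₀) (hB₂ : 0 ≤ B₂) (hσ : 0 ≤ σ) (hα : 0 ≤ α)
    (hρ : 0 ≤ ρ) (hρS : ρ ≤ δ₀) (hρδ : ρ + σ ≤ δK) (hq : θ * c < 1) (hq₂ : B₂ * θ₂ * c * c < 1)
    (hρf : 0 ≤ ρf) (hρf1 : ρf + σ ≤ (1 - α) * ρ) (hρf2 : ρf + 2 * σ + α * ρ ≤ ρ)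
    (hΛ₁ : 0 ≤ Λ₁) (hΛh : 0 ≤ Λh) (hΛm : 0 ≤ Λm)
    (hST1 : ScaleTransfer g ρ α Λ₁ (fun y => g.len y ^ (1 : ℝ)))
    (hSTh : ScaleTransfer g ρ α Λh (fun y => g.len y ^ (1 / 2 : ℝ)))
    (hSTm : ScaleTransfer g ρ α Λm (fun y => g.len y ^ (-1 : ℝ)))
    (hI0 : 𝔬.G0 U * 𝔬.S0 U = 1) (hIA : (𝔬.S0 U - T) * A = 1)
    (he0 : HasMajorant (g := toB6 g R₀ H₀) 𝔬.blk (𝔬.G0 U) (fun a b => B₀ * g.len a ^ 2 * Real.exp (-(δ₀ * g.dist a b))))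
    (he1 : HasMajorantHom (g := toB6 g R₀ H₀) 𝔬.blk 𝔬.blkY (𝔬.D U ∘ₗ 𝔬.G0 U)
      (fun (a b : g.Site) => B₀ * g.len a * Real.exp (-(δ₀ * g.dist a b))))
    (he2 : HasMajorantHom (g := toB6 g R₀ H₀) 𝔬.blkY 𝔬.blk (𝔬.G0 U ∘ₗ 𝔬.Dstar U)
      (fun (a b : g.Site) => B₀ * g.len a * Real.exp (-(δ₀ * g.dist a b))))
    (hL2 : Thm33G0L2P 𝔬 Dd Dds R₀ H₀ B₂ δ₀ U)
    (hK1 : HasMaj (cNorm R₀ H₀ 𝔬.blk hG.lenle 1) (cNorm R₀ H₀ 𝔬.blk hG.lenle 1) (𝔬.G0 U ∘ₗ T)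
      (fun a b => θ * Real.exp (-(δK * g.dist a b))))
    (hK2 : HasMaj (cNorm R₀ H₀ 𝔬.blk hG.lenle 2) (cNorm R₀ H₀ 𝔬.blk hG.lenle 2) (𝔬.G0 U ∘ₗ T)
      (fun a b => θ * Real.exp (-(δK * g.dist a b))))
    (hKD : HasMaj (cNorm R₀ H₀ 𝔬.blk hG.lenle 2) (cNorm R₀ H₀ 𝔬.blkY hG.lenle 1) (𝔬.D U ∘ₗ 𝔬.G0 U ∘ₗ T)
      (fun a b => θD * Real.exp (-(δK * g.dist a b))))
    (hT2 : BlockBd (g := toB6 g R₀ H₀) 𝔬.blk 𝔬.blk T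
      (fun (y y' : g.Site) => θ₂ * (g.len y)⁻¹ * (g.len y')⁻¹ * Real.exp (-(δK * g.dist y y'))))
    (hsym : IsTransposePair A A) (htr : IsTransposePair (𝔬.D U ∘ₗ A) (A ∘ₗ 𝔬.Dstar U)) :
    BlockBd (g := toB6 g R₀ H₀) 𝔬.blk 𝔬.blk A
        (fun (y y' : g.Site) => constL2N B₀ θ θD B₂ θ₂ c Λ₁ Λh Λm (Real.sqrt (Fintype.card (P × P))) * B9.pref6 (g.len y) 0 * Real.exp (-(ρf * g.dist y y'))) ∧
      BlockBd (g := toB6 g R₀ H₀) 𝔬.blk 𝔬.blkY (𝔬.D U ∘ₗ A)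
        (fun (y y' : g.Site) => constL2N B₀ θ θD B₂ θ₂ c Λ₁ Λh Λm (Real.sqrt (Fintype.card (P × P))) * B9.pref6 (g.len y) 1 * Real.exp (-(ρf * g.dist y y'))) ∧
      BlockBd (g := toB6 g R₀ H₀) 𝔬.blkY 𝔬.blk (A ∘ₗ 𝔬.Dstar U)
        (fun (y y' : g.Site) => constL2N B₀ θ θD B₂ θ₂ c Λ₁ Λh Λm (Real.sqrt (Fintype.card (P × P))) * B9.pref6 (g.len y) 2 * Real.exp (-(ρf * g.dist y y'))) ∧
      BlockBd (g := toB6 g R₀ H₀) 𝔬.blk (𝔬.blk ∘ Prod.fst) (familyOp (fun q : P × P => (Dd U q.1 ∘ₗ Dd U q.2) ∘ₗ A))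
        (fun (y y' : g.Site) => constL2N B₀ θ θD B₂ θ₂ c Λ₁ Λh Λm (Real.sqrt (Fintype.card (P × P))) * B9.pref6 (g.len y) 3 * Real.exp (-(ρf * g.dist y y'))) ∧
      BlockBd (g := toB6 g R₀ H₀) 𝔬.blkY 𝔬.blkY (𝔬.D U ∘ₗ (A ∘ₗ 𝔬.Dstar U))
        (fun (y y' : g.Site) => constL2N B₀ θ θD B₂ θ₂ c Λ₁ Λh Λm (Real.sqrt (Fintype.card (P × P))) * B9.pref6 (g.len y) 4 * Real.exp (-(ρf * g.dist y y'))) ∧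
      BlockBd (g := toB6 g R₀ H₀) 𝔬.blk (𝔬.blk ∘ Prod.fst) (familyOp (fun q : P × P => A ∘ₗ (Dds U q.1 ∘ₗ Dds U q.2)))
        (fun (y y' : g.Site) => constL2N B₀ θ θD B₂ θ₂ c Λ₁ Λh Λm (Real.sqrt (Fintype.card (P × P))) * B9.pref6 (g.len y) 5 * Real.exp (-(ρf * g.dist y y'))) := by
  -- the body of `B9Thm312WholeBlocksNbr.l2Block_of_step_nbr` up to the reading step
  have hc : 0 ≤ c ∨ IsEmpty g.Site := by
    by_cases hne : Nonempty g.Site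
    · exact Or.inl (hrow.nonneg hne.some)
    · exact Or.inr (not_nonempty_iff.mp hne)
  rcases hc with hc | hemp
  swap
  · exact ⟨fun y' μ hμ y => (hemp.false y).elim, fun y' μ hμ y => (hemp.false y).elim, fun y' μ hμ y => (hemp.false y).elim,
      fun y' μ hμ y => (hemp.false y).elim, fun y' μ hμ y => (hemp.false y).elim, fun y' μ hμ y => (hemp.false y).elim⟩
  -- constants
  set NP : ℝ := Real.sqrt (Fintype.card (P × P)) with hNP
  have hNP0 : 0 ≤ NP := Real.sqrt_nonneg _
  have hq1 : 0 ≤ (1 - θ * c)⁻¹ := inv_nonneg.mpr (by linarith)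
  have hB₀'0 : 0 ≤ B₀ * (1 - θ * c)⁻¹ := mul_nonneg hB₀ hq1
  have hC₁0 : 0 ≤ B₀ + θD * (B₀ * (1 - θ * c)⁻¹) * c := add_nonneg hB₀ (mul_nonneg (mul_nonneg hθD hB₀'0) hc)
  have hq₂1 : 0 ≤ (1 - B₂ * θ₂ * c * c)⁻¹ := inv_nonneg.mpr (by linarith)
  have hK₄0 : 0 ≤ B₂ + B₂ * (θ₂ * (B₂ * (1 - B₂ * θ₂ * c * c)⁻¹) * c) * c :=
    add_nonneg hB₂ (mul_nonneg (mul_nonneg hB₂ (mul_nonneg (mul_nonneg hθ₂ (mul_nonneg hB₂ hq₂1)) hc)) hc)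
  have ha0 : 0 ≤ B₀ * (1 - θ * c)⁻¹ * Λ₁ := mul_nonneg hB₀'0 hΛ₁
  have hb0 : 0 ≤ (B₀ + θD * (B₀ * (1 - θ * c)⁻¹) * c + B₀ * (1 - θ * c)⁻¹) * Λh := mul_nonneg (add_nonneg hC₁0 hB₀'0) hΛh
  have hNP1 : 0 ≤ NP * Λ₁ := mul_nonneg hNP0 hΛ₁
  have hNPm : 0 ≤ NP * Λm := mul_nonneg hNP0 hΛm
  have hs1 : 1 ≤ 1 + NP * Λ₁ + NP * Λm := by linarith
  have hc0 : B₂ + B₂ * (θ₂ * (B₂ * (1 - B₂ * θ₂ * c * c)⁻¹) * c) * c ≤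
      (B₂ + B₂ * (θ₂ * (B₂ * (1 - B₂ * θ₂ * c * c)⁻¹) * c) * c) * (1 + NP * Λ₁ + NP * Λm) :=
    le_mul_of_one_le_right hK₄0 hs1
  have hc3 : (B₂ + B₂ * (θ₂ * (B₂ * (1 - B₂ * θ₂ * c * c)⁻¹) * c) * c) * (NP * Λ₁) ≤
      (B₂ + B₂ * (θ₂ * (B₂ * (1 - B₂ * θ₂ * c * c)⁻¹) * c) * c) * (1 + NP * Λ₁ + NP * Λm) :=
    mul_le_mul_of_nonneg_left (by linarith) hK₄0
  have hc5 : (B₂ + B₂ * (θ₂ * (B₂ * (1 - B₂ * θ₂ * c * c)⁻¹) * c) * c) * (NP * Λm) ≤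
      (B₂ + B₂ * (θ₂ * (B₂ * (1 - B₂ * θ₂ * c * c)⁻¹) * c) * c) * (1 + NP * Λ₁ + NP * Λm) :=
    mul_le_mul_of_nonneg_left (by linarith) hK₄0
  have hcc : 0 ≤ (B₂ + B₂ * (θ₂ * (B₂ * (1 - B₂ * θ₂ * c * c)⁻¹) * c) * c) * (1 + NP * Λ₁ + NP * Λm) :=
    mul_nonneg hK₄0 (by linarith)
  have hKL0 : 0 ≤ constL2N B₀ θ θD B₂ θ₂ c Λ₁ Λh Λm NP := by unfold constL2N; linarith
  have hKLa : B₀ * (1 - θ * c)⁻¹ * Λ₁ ≤ constL2N B₀ θ θD B₂ θ₂ c Λ₁ Λh Λm NP := by unfold constL2N; linarith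
  have hKLb : (B₀ + θD * (B₀ * (1 - θ * c)⁻¹) * c + B₀ * (1 - θ * c)⁻¹) * Λh ≤ constL2N B₀ θ θD B₂ θ₂ c Λ₁ Λh Λm NP := by
    unfold constL2N; linarith
  have hKL4 : B₂ + B₂ * (θ₂ * (B₂ * (1 - B₂ * θ₂ * c * c)⁻¹) * c) * c ≤ constL2N B₀ θ θD B₂ θ₂ c Λ₁ Λh Λm NP := by
    unfold constL2N; linarith
  have hKL3 : (B₂ + B₂ * (θ₂ * (B₂ * (1 - B₂ * θ₂ * c * c)⁻¹) * c) * c) * (NP * Λ₁) ≤ constL2N B₀ θ θD B₂ θ₂ c Λ₁ Λh Λm NP := by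
    unfold constL2N; linarith
  have hKL5 : (B₂ + B₂ * (θ₂ * (B₂ * (1 - B₂ * θ₂ * c * c)⁻¹) * c) * c) * (NP * Λm) ≤ constL2N B₀ θ θD B₂ θ₂ c Λ₁ Λh Λm NP := by
    unfold constL2N; linarith
  -- rates
  have hαρ : 0 ≤ α * ρ := mul_nonneg hα hρ
  have hρf_le : ρf ≤ (1 - α) * ρ := by linarith
  have h1αρ : (1 - α) * ρ ≤ ρ := by linarith
  have hρL0 : 0 ≤ ρf + α * ρ := add_nonneg hρf hαρ
  have hρL2 : ρf + α * ρ + 2 * σ ≤ ρ := by linarith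
  have hexp : ∀ {r₁ r' : ℝ}, r' ≤ r₁ → ∀ y y' : g.Site, Real.exp (-(r₁ * g.dist y y')) ≤ Real.exp (-(r' * g.dist y y')) :=
    fun h y y' => Real.exp_le_exp.mpr (neg_le_neg (mul_le_mul_of_nonneg_right h (hG.dnn y y')))
  -- (3.130)
  have hfix : A = 𝔬.G0 U + 𝔬.G0 U ∘ₗ T ∘ₗ A := fix_of_inverses hI0 hIA
  -- the sup majorants of A, ∇_UA, A∇* (proved upstream)
  have hm0 := entry0_of_step hG hrow hθ hB₀ hρ hρS hρδ hK2 he0 hfix hq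
  have hm1 := entry1_of_stepD hG hrow hθ hθD hB₀ hρ hρS hρδ hK2 hKD he0 he1 hfix hq
  have hm2 := entry2_of_step hG hrow hθ hB₀ hρ hρS hρδ hK1 he2 hfix hq
  -- lines 0, 1, 2 by Schur
  have hb0 := l2bd_entry0_of_sup (R₀ := R₀) (H₀ := H₀) hG hB₀'0 hST1 hm0 hsym
  have hm1' : HasMajorantHom (g := toB6 g R₀ H₀) 𝔬.blk 𝔬.blkY (𝔬.D U ∘ₗ A)
      (fun (a b : g.Site) => (B₀ + θD * (B₀ * (1 - θ * c)⁻¹) * c + B₀ * (1 - θ * c)⁻¹) * g.len a *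
        Real.exp (-(ρ * g.dist a b))) :=
    hasMajorantHom_mono (g := toB6 g R₀ H₀) 𝔬.blk 𝔬.blkY hm1 fun a b =>
      mul_le_mul_of_nonneg_right (mul_le_mul_of_nonneg_right (by linarith) (hG.lenle a)) (Real.exp_nonneg _)
  have hm2' : HasMajorantHom (g := toB6 g R₀ H₀) 𝔬.blkY 𝔬.blk (A ∘ₗ 𝔬.Dstar U)
      (fun (a b : g.Site) => (B₀ + θD * (B₀ * (1 - θ * c)⁻¹) * c + B₀ * (1 - θ * c)⁻¹) * g.len a *
        Real.exp (-(ρ * g.dist a b))) :=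
    hasMajorantHom_mono (g := toB6 g R₀ H₀) 𝔬.blkY 𝔬.blk hm2 fun a b =>
      mul_le_mul_of_nonneg_right (mul_le_mul_of_nonneg_right (by linarith) (hG.lenle a)) (Real.exp_nonneg _)
  obtain ⟨hb1, hb2⟩ := l2bd_entry12_of_sup (R₀ := R₀) (H₀ := H₀) hG (add_nonneg hC₁0 hB₀'0) hSTh hm1' hm2' htr
  -- lines 3, 4, 5 by r1's Neumann bookkeeping at the rate ρf + αρ (schemas brought to the common rate ρ)
  have hL2ρ : Thm33G0L2P 𝔬 Dd Dds R₀ H₀ B₂ ρ U := by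
    have hl : ∀ y : g.Site, 0 ≤ g.len y := hG.lenle
    have hli : ∀ y : g.Site, 0 ≤ (g.len y)⁻¹ := fun y => inv_nonneg.mpr (hl y)
    exact
      { l0 := hL2.l0.mono fun y y' => mul_le_mul_of_nonneg_left (hexp hρS y y') (mul_nonneg (mul_nonneg hB₂ (hl y)) (hl y'))
        l1 := hL2.l1.mono fun y y' => mul_le_mul_of_nonneg_left (hexp hρS y y') (mul_nonneg hB₂ (hl y'))
        l2 := hL2.l2.mono fun y y' => mul_le_mul_of_nonneg_left (hexp hρS y y') (mul_nonneg hB₂ (hl y))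
        l3 := fun q => (hL2.l3 q).mono fun y y' =>
          mul_le_mul_of_nonneg_left (hexp hρS y y') (mul_nonneg hB₂ (mul_nonneg (hli y) (hl y')))
        l4 := hL2.l4.mono fun y y' => mul_le_mul_of_nonneg_left (hexp hρS y y') hB₂
        l5 := fun q => (hL2.l5 q).mono fun y y' =>
          mul_le_mul_of_nonneg_left (hexp hρS y y') (mul_nonneg hB₂ (mul_nonneg (hl y) (hli y'))) }
  have hT2ρ : BlockBd (g := toB6 g R₀ H₀) 𝔬.blk 𝔬.blk T
      (fun (y y' : g.Site) => θ₂ * (g.len y)⁻¹ * (g.len y')⁻¹ * Real.exp (-(ρ * g.dist y y'))) :=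
    hT2.mono fun y y' => mul_le_mul_of_nonneg_left (hexp (by linarith) y y')
      (mul_nonneg (mul_nonneg hθ₂ (inv_nonneg.mpr (hG.lenle y))) (inv_nonneg.mpr (hG.lenle y')))
  have hb4 := l2bd_entry4_of_step (Lap := fun _ => (0 : Module.End ℝ (X → ℝ))) hG hrow hB₂ hθ₂ hρL0 hσ hρL2
    (Thm33G0L2P.toLap hB₂ hG.lenle hL2ρ) hT2ρ hfix hq₂
  have hb3 := l2bd_family3_of_step hG hrow hB₂ hθ₂ hρL0 hσ hρL2 hΛ₁ hST1 hL2ρ hT2ρ hfix hq₂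
  have hb5 := l2bd_family5_of_step hG hrow hB₂ hθ₂ hρL0 hσ hρL2 hΛm hSTm hL2ρ hT2ρ hfix hq₂
  have hρL' : ρf + α * ρ - α * ρ = ρf := by ring
  rw [hρL'] at hb3 hb5
  -- all six at (constL2N, ρf) in the pref6 shapes
  have hP : ∀ t : ℝ, B9.pref6 t 0 = t ^ 2 ∧ B9.pref6 t 1 = t ∧ B9.pref6 t 2 = t ∧ B9.pref6 t 3 = 1 ∧ B9.pref6 t 4 = 1 ∧
      B9.pref6 t 5 = 1 := fun t => by simp [B9.pref6]
  have hw : ∀ {Kx r₁ : ℝ} (Pw : g.Site → ℝ), (∀ y, 0 ≤ Pw y) → Kx ≤ constL2N B₀ θ θD B₂ θ₂ c Λ₁ Λh Λm NP → ρf ≤ r₁ →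
      ∀ y y' : g.Site, Kx * Pw y * Real.exp (-(r₁ * g.dist y y')) ≤
        constL2N B₀ θ θD B₂ θ₂ c Λ₁ Λh Λm NP * Pw y * Real.exp (-(ρf * g.dist y y')) :=
    fun Pw hPw hK hr₁ y y' => mul_le_mul (mul_le_mul_of_nonneg_right hK (hPw y)) (hexp hr₁ y y') (Real.exp_nonneg _)
      (mul_nonneg hKL0 (hPw y))
  have hB0 : BlockBd (g := toB6 g R₀ H₀) 𝔬.blk 𝔬.blk A
      (fun (y y' : g.Site) => constL2N B₀ θ θD B₂ θ₂ c Λ₁ Λh Λm NP * B9.pref6 (g.len y) 0 * Real.exp (-(ρf * g.dist y y'))) := by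
    refine hb0.mono fun y y' => ?_
    rw [(hP (g.len y)).1]
    have h := hw (Kx := B₀ * (1 - θ * c)⁻¹ * Λ₁) (r₁ := (1 - α) * ρ) (fun y => g.len y ^ 2) (fun y => sq_nonneg _) hKLa
      hρf_le y y'
    simpa only [mul_assoc] using h
  have hB1 : BlockBd (g := toB6 g R₀ H₀) 𝔬.blk 𝔬.blkY (𝔬.D U ∘ₗ A)
      (fun (y y' : g.Site) => constL2N B₀ θ θD B₂ θ₂ c Λ₁ Λh Λm NP * B9.pref6 (g.len y) 1 * Real.exp (-(ρf * g.dist y y'))) := by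
    refine hb1.mono fun y y' => ?_
    rw [(hP (g.len y)).2.1]
    have h := hw (Kx := (B₀ + θD * (B₀ * (1 - θ * c)⁻¹) * c + B₀ * (1 - θ * c)⁻¹) * Λh) (r₁ := (1 - α) * ρ)
      (fun y => g.len y) hG.lenle hKLb hρf_le y y'
    simpa only [mul_assoc] using h
  have hB2 : BlockBd (g := toB6 g R₀ H₀) 𝔬.blkY 𝔬.blk (A ∘ₗ 𝔬.Dstar U)
      (fun (y y' : g.Site) => constL2N B₀ θ θD B₂ θ₂ c Λ₁ Λh Λm NP * B9.pref6 (g.len y) 2 * Real.exp (-(ρf * g.dist y y'))) := by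
    refine hb2.mono fun y y' => ?_
    rw [(hP (g.len y)).2.2.1]
    have h := hw (Kx := (B₀ + θD * (B₀ * (1 - θ * c)⁻¹) * c + B₀ * (1 - θ * c)⁻¹) * Λh) (r₁ := (1 - α) * ρ)
      (fun y => g.len y) hG.lenle hKLb hρf_le y y'
    simpa only [mul_assoc] using h
  have hB3 : BlockBd (g := toB6 g R₀ H₀) 𝔬.blk (𝔬.blk ∘ Prod.fst) (familyOp (fun q : P × P => (Dd U q.1 ∘ₗ Dd U q.2) ∘ₗ A))
      (fun (y y' : g.Site) => constL2N B₀ θ θD B₂ θ₂ c Λ₁ Λh Λm NP * B9.pref6 (g.len y) 3 * Real.exp (-(ρf * g.dist y y'))) := by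
    refine hb3.mono fun y y' => ?_
    rw [(hP (g.len y)).2.2.2.1, mul_one]
    calc NP * ((B₂ + B₂ * (θ₂ * (B₂ * (1 - B₂ * θ₂ * c * c)⁻¹) * c) * c) * Λ₁ * Real.exp (-(ρf * g.dist y y')))
        = (B₂ + B₂ * (θ₂ * (B₂ * (1 - B₂ * θ₂ * c * c)⁻¹) * c) * c) * (NP * Λ₁) * Real.exp (-(ρf * g.dist y y')) := by ring
      _ ≤ constL2N B₀ θ θD B₂ θ₂ c Λ₁ Λh Λm NP * Real.exp (-(ρf * g.dist y y')) :=
          mul_le_mul_of_nonneg_right hKL3 (Real.exp_nonneg _)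
  have hB4 : BlockBd (g := toB6 g R₀ H₀) 𝔬.blkY 𝔬.blkY (𝔬.D U ∘ₗ (A ∘ₗ 𝔬.Dstar U))
      (fun (y y' : g.Site) => constL2N B₀ θ θD B₂ θ₂ c Λ₁ Λh Λm NP * B9.pref6 (g.len y) 4 * Real.exp (-(ρf * g.dist y y'))) := by
    refine hb4.mono fun y y' => ?_
    rw [(hP (g.len y)).2.2.2.2.1, mul_one]
    exact mul_le_mul hKL4 (hexp (by linarith) y y') (Real.exp_nonneg _) hKL0
  have hB5 : BlockBd (g := toB6 g R₀ H₀) 𝔬.blk (𝔬.blk ∘ Prod.fst) (familyOp (fun q : P × P => A ∘ₗ (Dds U q.1 ∘ₗ Dds U q.2)))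
      (fun (y y' : g.Site) => constL2N B₀ θ θD B₂ θ₂ c Λ₁ Λh Λm NP * B9.pref6 (g.len y) 5 * Real.exp (-(ρf * g.dist y y'))) := by
    refine hb5.mono fun y y' => ?_
    rw [(hP (g.len y)).2.2.2.2.2, mul_one]
    calc NP * ((B₂ + B₂ * (θ₂ * (B₂ * (1 - B₂ * θ₂ * c * c)⁻¹) * c) * c) * Λm * Real.exp (-(ρf * g.dist y y')))
        = (B₂ + B₂ * (θ₂ * (B₂ * (1 - B₂ * θ₂ * c * c)⁻¹) * c) * c) * (NP * Λm) * Real.exp (-(ρf * g.dist y y')) := by ring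
      _ ≤ constL2N B₀ θ θD B₂ θ₂ c Λ₁ Λh Λm NP * Real.exp (-(ρf * g.dist y y')) :=
          mul_le_mul_of_nonneg_right hKL5 (Real.exp_nonneg _)
  exact ⟨hB0, hB1, hB2, hB3, hB4, hB5⟩

/-- ★ **THE L² BLOCK (3.46) OF A CO-READ KERNEL FAMILY from six block-L² bounds of printed shape, RECORD INDEX ORDER**: as
`…BlocksNbr.l2Block_of_blockBds_nbr` but with the member n = 3 read by the MIXED model A₄ (types of ∇_UA∇\*_U, lattice Y) and the member n = 4 by the
pair-family model A₃ (types of ∇_ν∇_μA, from X into X₃) — the order of `Node00.kernelFamilyB.l2`; the printed weights of lines 3 and 4 agree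
(pref6 = 1), so the operator-level inputs are unchanged. [cite: Balaban1985BackgroundPropagators, (3.46) p.398 + p.397 (Δ̃); Balaban1984PropagatorsII, (2.51)–(2.52) p.232] -/
theorem l2Block_of_blockBds_nbrRec (hG : GeoOK g) {X₃ : Type} [Fintype X₃] {K : B9.KernelFamily g B} {U : B.Cfg}
    {Rel : g.Site → g.Site → Prop} [DecidableRel Rel]
    {r Cev : ℝ} {blk : X → g.Site} {blkY : Y → g.Site} {blk₃ : X₃ → g.Site} {ev : g.Loc → X → ℝ} {evY : g.Loc → Y → ℝ}
    {A0 : Module.End ℝ (X → ℝ)} {A1 : (X → ℝ) →ₗ[ℝ] (Y → ℝ)} {A2 : (Y → ℝ) →ₗ[ℝ] (X → ℝ)} {A4 : Module.End ℝ (Y → ℝ)}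
    {A3 A5 : (X → ℝ) →ₗ[ℝ] (X₃ → ℝ)}
    (hRd₂ : ∀ a b b', Rel b b' → g.dist a b = g.dist a b')
    {m : ℕ} (hmult : ∀ y' : g.Site, (Finset.univ.filter (fun y'' => Rel y'' y')).card ≤ m)
    {mN : ℕ} (hnbr : ∀ y : g.Site, (nbr g r y).card ≤ mN)
    {CL : ℝ} (hCL1 : 1 ≤ CL) (hCL : ∀ a a' : g.Site, g.dist a a' ≤ r → g.len a ≤ CL * g.len a') (hCev : 0 ≤ Cev)
    {KL δ : ℝ} (hKL : 0 ≤ KL) (hδ : 0 ≤ δ)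
    (hb0 : BlockBd (g := toB6 g R₀ H₀) blk blk A0 (fun (y y' : g.Site) => KL * B9.pref6 (g.len y) 0 * Real.exp (-(δ * g.dist y y'))))
    (hb1 : BlockBd (g := toB6 g R₀ H₀) blk blkY A1 (fun (y y' : g.Site) => KL * B9.pref6 (g.len y) 1 * Real.exp (-(δ * g.dist y y'))))
    (hb2 : BlockBd (g := toB6 g R₀ H₀) blkY blk A2 (fun (y y' : g.Site) => KL * B9.pref6 (g.len y) 2 * Real.exp (-(δ * g.dist y y'))))
    (hb3 : BlockBd (g := toB6 g R₀ H₀) blk blk₃ A3 (fun (y y' : g.Site) => KL * B9.pref6 (g.len y) 3 * Real.exp (-(δ * g.dist y y'))))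
    (hb4 : BlockBd (g := toB6 g R₀ H₀) blkY blkY A4 (fun (y y' : g.Site) => KL * B9.pref6 (g.len y) 4 * Real.exp (-(δ * g.dist y y'))))
    (hb5 : BlockBd (g := toB6 g R₀ H₀) blk blk₃ A5 (fun (y y' : g.Site) => KL * B9.pref6 (g.len y) 5 * Real.exp (-(δ * g.dist y y'))))
    (hl0 : L2ReadsNbr (R := R₀) (H := H₀) K 0 U Rel r Cev blk blk ev A0)
    (hl1 : L2ReadsNbr (R := R₀) (H := H₀) K 1 U Rel r Cev blkY blk ev A1)
    (hl2 : L2ReadsNbr (R := R₀) (H := H₀) K 2 U Rel r Cev blk blkY evY A2)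
    (hl3 : L2ReadsNbr (R := R₀) (H := H₀) K 3 U Rel r Cev blkY blkY evY A4)
    (hl4 : L2ReadsNbr (R := R₀) (H := H₀) K 4 U Rel r Cev blk₃ blk ev A3)
    (hl5 : L2ReadsNbr (R := R₀) (H := H₀) K 5 U Rel r Cev blk₃ blk ev A5) :
    L2Block K (mN * m * Cev * CL ^ 2 * Real.exp (r * δ) * KL) δ U := by
  have hP : ∀ t : ℝ, B9.pref6 t 3 = B9.pref6 t 4 := fun t => by simp [B9.pref6]
  have hb3' : BlockBd (g := toB6 g R₀ H₀) blk blk₃ A3 (fun (y y' : g.Site) => KL * B9.pref6 (g.len y) 4 * Real.exp (-(δ * g.dist y y'))) :=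
    hb3.mono fun y y' => by rw [hP]
  have hb4' : BlockBd (g := toB6 g R₀ H₀) blkY blkY A4 (fun (y y' : g.Site) => KL * B9.pref6 (g.len y) 3 * Real.exp (-(δ * g.dist y y'))) :=
    hb4.mono fun y y' => by rw [hP]
  intro n
  fin_cases n
  · exact l2line_of_blockBd_nbr hl0 hRd₂ hmult hnbr hCL1 hCL hG.tri hG.symm hKL hδ hCev hG.lenle hb0
  · exact l2line_of_blockBd_nbr hl1 hRd₂ hmult hnbr hCL1 hCL hG.tri hG.symm hKL hδ hCev hG.lenle hb1
  · exact l2line_of_blockBd_nbr hl2 hRd₂ hmult hnbr hCL1 hCL hG.tri hG.symm hKL hδ hCev hG.lenle hb2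
  · exact l2line_of_blockBd_nbr hl3 hRd₂ hmult hnbr hCL1 hCL hG.tri hG.symm hKL hδ hCev hG.lenle hb4'
  · exact l2line_of_blockBd_nbr hl4 hRd₂ hmult hnbr hCL1 hCL hG.tri hG.symm hKL hδ hCev hG.lenle hb3'
  · exact l2line_of_blockBd_nbr hl5 hRd₂ hmult hnbr hCL1 hCL hG.tri hG.symm hKL hδ hCev hG.lenle hb5

/-- ★ **THEOREM 3.12 — THE L² BLOCK (3.46) OF A KERNEL FAMILY CO-READ ON THE NEIGHBOURHOOD BY ONE SECT.-D PROPAGATOR, RECORD INDEX ORDER** (the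
twin of `…BlocksNbr.l2Block_of_step_nbr` with the co-readings of n = 3 and n = 4 exchanged: `K.l2 3` read by the mixed ∇_UA∇\*_U on the lattice Y,
`K.l2 4` by the pair family `familyOp (q ↦ ∇_{q.1}∇_{q.2}∘A)` on X × (P × P) — the order of `Node00.kernelFamilyB.l2`), from `blockBds_of_step` and
`l2Block_of_blockBds_nbrRec`.  Conclusion: `L2Block K (mN·m·Cev·CL²·e^{rρ_f}·constL2N …) ρ_f U`.  Nothing of print asserted.
[cite: Balaban1985BackgroundPropagators, Thm 3.12 p.423 + Thm 3.3 p.399 + (3.46) p.398 + (3.39) p.397 + (3.130)–(3.131) pp.421–422; Balaban1984PropagatorsII, (2.51)–(2.52) p.232 + Lemma 2.1 (2.60)–(2.61) p.234] -/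
theorem l2Block_of_step_nbrRec (hG : GeoOK g) {K : B9.KernelFamily g B} {U : B.Cfg} (𝔬 : Ops g B X Y Z W)
    (Dd Dds : B.Cfg → P → Module.End ℝ (X → ℝ)) (Rel : g.Site → g.Site → Prop) [DecidableRel Rel]
    (ev : g.Loc → X → ℝ) (evY : g.Loc → Y → ℝ) {A T : Module.End ℝ (X → ℝ)} {m mN : ℕ}
    {r Cev CL θ θD θ₂ B₀ B₂ δ₀ δK ρ ρf σ α c Λ₁ Λh Λm : ℝ}
    (hrow : RowSum (toB6 g R₀ H₀) σ c)
    (hθ : 0 ≤ θ) (hθD : 0 ≤ θD) (hθ₂ : 0 ≤ θ₂) (hB₀ : 0 ≤ B₀) (hB₂ : 0 ≤ B₂) (hσ : 0 ≤ σ) (hα : 0 ≤ α)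
    (hρ : 0 ≤ ρ) (hρS : ρ ≤ δ₀) (hρδ : ρ + σ ≤ δK) (hq : θ * c < 1) (hq₂ : B₂ * θ₂ * c * c < 1)
    (hρf : 0 ≤ ρf) (hρf1 : ρf + σ ≤ (1 - α) * ρ) (hρf2 : ρf + 2 * σ + α * ρ ≤ ρ)
    (hΛ₁ : 0 ≤ Λ₁) (hΛh : 0 ≤ Λh) (hΛm : 0 ≤ Λm)
    (hST1 : ScaleTransfer g ρ α Λ₁ (fun y => g.len y ^ (1 : ℝ)))
    (hSTh : ScaleTransfer g ρ α Λh (fun y => g.len y ^ (1 / 2 : ℝ)))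
    (hSTm : ScaleTransfer g ρ α Λm (fun y => g.len y ^ (-1 : ℝ)))
    (hI0 : 𝔬.G0 U * 𝔬.S0 U = 1) (hIA : (𝔬.S0 U - T) * A = 1)
    (he0 : HasMajorant (g := toB6 g R₀ H₀) 𝔬.blk (𝔬.G0 U) (fun a b => B₀ * g.len a ^ 2 * Real.exp (-(δ₀ * g.dist a b))))
    (he1 : HasMajorantHom (g := toB6 g R₀ H₀) 𝔬.blk 𝔬.blkY (𝔬.D U ∘ₗ 𝔬.G0 U)
      (fun (a b : g.Site) => B₀ * g.len a * Real.exp (-(δ₀ * g.dist a b))))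
    (he2 : HasMajorantHom (g := toB6 g R₀ H₀) 𝔬.blkY 𝔬.blk (𝔬.G0 U ∘ₗ 𝔬.Dstar U)
      (fun (a b : g.Site) => B₀ * g.len a * Real.exp (-(δ₀ * g.dist a b))))
    (hL2 : Thm33G0L2P 𝔬 Dd Dds R₀ H₀ B₂ δ₀ U)
    (hK1 : HasMaj (cNorm R₀ H₀ 𝔬.blk hG.lenle 1) (cNorm R₀ H₀ 𝔬.blk hG.lenle 1) (𝔬.G0 U ∘ₗ T)
      (fun a b => θ * Real.exp (-(δK * g.dist a b))))
    (hK2 : HasMaj (cNorm R₀ H₀ 𝔬.blk hG.lenle 2) (cNorm R₀ H₀ 𝔬.blk hG.lenle 2) (𝔬.G0 U ∘ₗ T)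
      (fun a b => θ * Real.exp (-(δK * g.dist a b))))
    (hKD : HasMaj (cNorm R₀ H₀ 𝔬.blk hG.lenle 2) (cNorm R₀ H₀ 𝔬.blkY hG.lenle 1) (𝔬.D U ∘ₗ 𝔬.G0 U ∘ₗ T)
      (fun a b => θD * Real.exp (-(δK * g.dist a b))))
    (hT2 : BlockBd (g := toB6 g R₀ H₀) 𝔬.blk 𝔬.blk T
      (fun (y y' : g.Site) => θ₂ * (g.len y)⁻¹ * (g.len y')⁻¹ * Real.exp (-(δK * g.dist y y'))))
    (hsym : IsTransposePair A A) (htr : IsTransposePair (𝔬.D U ∘ₗ A) (A ∘ₗ 𝔬.Dstar U))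
    (hRd₂ : ∀ a b b', Rel b b' → g.dist a b = g.dist a b')
    (hmult : ∀ y' : g.Site, (Finset.univ.filter (fun y'' => Rel y'' y')).card ≤ m)
    (hnbr : ∀ y : g.Site, (nbr g r y).card ≤ mN)
    (hCL1 : 1 ≤ CL) (hCL : ∀ a a' : g.Site, g.dist a a' ≤ r → g.len a ≤ CL * g.len a') (hCev : 0 ≤ Cev)
    (hl0 : L2ReadsNbr (R := R₀) (H := H₀) K 0 U Rel r Cev 𝔬.blk 𝔬.blk ev A)
    (hl1 : L2ReadsNbr (R := R₀) (H := H₀) K 1 U Rel r Cev 𝔬.blkY 𝔬.blk ev (𝔬.D U ∘ₗ A))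
    (hl2 : L2ReadsNbr (R := R₀) (H := H₀) K 2 U Rel r Cev 𝔬.blk 𝔬.blkY evY (A ∘ₗ 𝔬.Dstar U))
    (hl3 : L2ReadsNbr (R := R₀) (H := H₀) K 3 U Rel r Cev 𝔬.blkY 𝔬.blkY evY (𝔬.D U ∘ₗ (A ∘ₗ 𝔬.Dstar U)))
    (hl4 : L2ReadsNbr (R := R₀) (H := H₀) K 4 U Rel r Cev (𝔬.blk ∘ Prod.fst) 𝔬.blk ev
      (familyOp (fun q : P × P => (Dd U q.1 ∘ₗ Dd U q.2) ∘ₗ A)))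
    (hl5 : L2ReadsNbr (R := R₀) (H := H₀) K 5 U Rel r Cev (𝔬.blk ∘ Prod.fst) 𝔬.blk ev
      (familyOp (fun q : P × P => A ∘ₗ (Dds U q.1 ∘ₗ Dds U q.2)))) :
    L2Block K (mN * m * Cev * CL ^ 2 * Real.exp (r * ρf) *
      constL2N B₀ θ θD B₂ θ₂ c Λ₁ Λh Λm (Real.sqrt (Fintype.card (P × P)))) ρf U := by
  obtain ⟨hB0, hB1, hB2, hB3, hB4, hB5⟩ := blockBds_of_step hG 𝔬 Dd Dds hrow hθ hθD hθ₂ hB₀ hB₂ hσ hα hρ hρS hρδ hq hq₂ hρf hρf1 hρf2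
    hΛ₁ hΛh hΛm hST1 hSTh hSTm hI0 hIA he0 he1 he2 hL2 hK1 hK2 hKD hT2 hsym htr
  -- the constant is non-negative as soon as there is a site
  have hc : 0 ≤ c ∨ IsEmpty g.Site := by
    by_cases hne : Nonempty g.Site
    · exact Or.inl (hrow.nonneg hne.some)
    · exact Or.inr (not_nonempty_iff.mp hne)
  rcases hc with hc | hemp
  swap
  · exact fun n lam h y => (hemp.false y).elim
  have hq1 : 0 ≤ (1 - θ * c)⁻¹ := inv_nonneg.mpr (by linarith)
  have hB₀'0 : 0 ≤ B₀ * (1 - θ * c)⁻¹ := mul_nonneg hB₀ hq1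
  have hC₁0 : 0 ≤ B₀ + θD * (B₀ * (1 - θ * c)⁻¹) * c := add_nonneg hB₀ (mul_nonneg (mul_nonneg hθD hB₀'0) hc)
  have hq₂1 : 0 ≤ (1 - B₂ * θ₂ * c * c)⁻¹ := inv_nonneg.mpr (by linarith)
  have hK₄0 : 0 ≤ B₂ + B₂ * (θ₂ * (B₂ * (1 - B₂ * θ₂ * c * c)⁻¹) * c) * c :=
    add_nonneg hB₂ (mul_nonneg (mul_nonneg hB₂ (mul_nonneg (mul_nonneg hθ₂ (mul_nonneg hB₂ hq₂1)) hc)) hc)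
  have hNP0 : 0 ≤ Real.sqrt (Fintype.card (P × P)) := Real.sqrt_nonneg _
  have hKL0 : 0 ≤ constL2N B₀ θ θD B₂ θ₂ c Λ₁ Λh Λm (Real.sqrt (Fintype.card (P × P))) := by
    unfold constL2N
    have h1 : 0 ≤ B₀ * (1 - θ * c)⁻¹ * Λ₁ := mul_nonneg hB₀'0 hΛ₁
    have h2 : 0 ≤ (B₀ + θD * (B₀ * (1 - θ * c)⁻¹) * c + B₀ * (1 - θ * c)⁻¹) * Λh := mul_nonneg (add_nonneg hC₁0 hB₀'0) hΛh
    have h3 : 0 ≤ (B₂ + B₂ * (θ₂ * (B₂ * (1 - B₂ * θ₂ * c * c)⁻¹) * c) * c) *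
        (1 + Real.sqrt (Fintype.card (P × P)) * Λ₁ + Real.sqrt (Fintype.card (P × P)) * Λm) :=
      mul_nonneg hK₄0 (by have := mul_nonneg hNP0 hΛ₁; have := mul_nonneg hNP0 hΛm; linarith)
    linarith
  exact l2Block_of_blockBds_nbrRec hG hRd₂ hmult hnbr hCL1 hCL hCev hKL0 hρf hB0 hB1 hB2 hB3 hB4 hB5 hl0 hl1 hl2 hl3 hl4 hl5

end OneMember

end

end Literature.MathematicalPhysics.QuantumFieldTheory.Balaban1983to89.B9Thm312WholeBlocksNbrRec
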